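import Literature.MathematicalPhysics.StatisticalMechanics.TorusFRDMultipliers
import Literature.MathematicalPhysics.StatisticalMechanics.FRDScaleMixing
import HarnessLib

/-!
# The final Fourier multipliers of the torus finite-range decomposition (Prop 3.1 and Thm 2.4, per mode)

Topic `Literature/MathematicalPhysics/StatisticalMechanics`.  In the scalar case all operators are
diagonal in the Fourier basis, so Buchholz's Prop 3.1 (scale mixing) and the proof of Thm 2.4
(subtract and re-add the reference decomposition) act mode by mode on the base multipliers
`ĉ_k(A,κ)` of `TorusFRDMultipliers.lean`:

* `mixMult ν` — `𝒟̂^ν_k(A,κ) = Σ_{j≤k} λ^ν_{k,j} ĉ_j(A,κ)`, `λ^ν` the mixing coefficients with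
  `γ = d − 1 + ν` (`FRDScaleMixing.lean`); shell bounds `mixMult_lower_*`, `exists_mixMult_deriv_upper`
  (Buchholz (3.4)–(3.6), for all `ℓ`), the shell cover `exists_inShell`, and the quotient bound (3.7)
  `exists_mixMult_ratio`;
* `finalMult` — `f_k(A,κ) = 𝒟̂^ñ_k(A) − θ 𝒟̂^ñ_k(A₀) + θ 𝒟̂^n_k(A₀)`, `θ = L^{-2(d+ñ)-1}/K`,
  `A₀ = Ω₀·1` the reference operator (Buchholz takes `−Δ`; any fixed member of the class works):
  `finalMult_nonneg`, `sum_finalMult` (`= 1/â`), and the bounds of Thm 2.4 (v):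
  `finalMult_lower_lt/ge`, `finalMult_upper_lt/ge`, `finalMult_deriv_upper_lt/ge`.

Everything is proved; no named facts.

## References
* S. Buchholz, *Finite range decomposition for Gaussian measures with improved regularity*,
  J. Funct. Anal. 275 (2018), Prop 3.1 (3.4)–(3.7) and the proof of Thm 2.4, (3.17)–(3.21) [Buchholz2016].
-/

noncomputable section

namespace Literature.MathematicalPhysics.StatisticalMechanics.GradientFRD

open Finset Literature.Analysis.Fourier Literature.Probability.LatticeModels
open scoped Real BigOperators

variable {d M : ℕ} [NeZero M]

/-! ## Tools: shells -/

/-- Every nonzero mode lies in some shell `𝔸_j`. [cite: Buchholz2016, §2 (the annuli 𝔸_j)] -/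
theorem exists_inShell {L : ℕ} (hL : 2 ≤ L) {κ : Fin d → ZMod M} (hκ : κ ≠ 0) : ∃ j, InShell L j κ := by
  have hp := momNorm_pos hκ
  have hL1 : (1 : ℝ) < L := by exact_mod_cast (show 1 < L by omega)
  classical
  -- some `j` with `L^{-(j+1)} < |p|`
  have hex : ∃ j : ℕ, ((L : ℝ) ^ (j + 1))⁻¹ < momNorm κ := by
    obtain ⟨n, hn⟩ := exists_pow_lt_of_lt_one hp (show (L : ℝ)⁻¹ < 1 from inv_lt_one_of_one_lt₀ hL1)
    refine ⟨n, lt_of_le_of_lt ?_ hn⟩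
    rw [inv_pow]
    exact inv_anti₀ (by positivity) (pow_le_pow_right₀ hL1.le (by omega))
  set j := Nat.find hex with hj
  have hjspec : ((L : ℝ) ^ (j + 1))⁻¹ < momNorm κ := Nat.find_spec hex
  rcases Nat.eq_zero_or_pos j with h0 | hpos
  · refine ⟨0, Or.inl ⟨rfl, ?_⟩⟩
    rw [pow_one]; rw [h0, zero_add, pow_one] at hjspec; exact hjspec
  · refine ⟨j, Or.inr ⟨hpos, hjspec, ?_⟩⟩
    have hmin := Nat.find_min hex (m := j - 1) (by omega)
    rw [show j - 1 + 1 = j by omega, not_lt] at hmin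
    exact hmin

/-- Shells beyond the torus resolution are empty: `InShell L j κ`, `κ ≠ 0`, `M = L^N` force `j ≤ N`.
[cite: Buchholz2016, §2 (dual torus)] -/
theorem inShell_le {L N : ℕ} (hL : 5 ≤ L) (hM : M = L ^ N) {j : ℕ} {κ : Fin d → ZMod M} (hκ : κ ≠ 0)
    (hj : InShell L j κ) : j ≤ N := by
  by_contra h
  push Not at h
  have hL0 : (0 : ℝ) < L := by exact_mod_cast (show 0 < L by omega)
  have hL1 : (1 : ℝ) ≤ L := by exact_mod_cast (show 1 ≤ L by omega)
  have hup : momNorm κ ≤ ((L : ℝ) ^ j)⁻¹ := by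
    rcases hj with ⟨h0, _⟩ | ⟨_, _, h2⟩
    · omega
    · exact h2
  -- `|p| ≥ 2π/M = 2π/L^N > 1/L^{N+1} ≥ 1/L^j`
  have hlow : 2 * π / M ≤ momNorm κ := by
    have h1 := supNorm_le_momNorm κ
    have hs : (1 : ℝ) ≤ supNorm κ := by exact_mod_cast one_le_supNorm hκ
    have hMpos : (0 : ℝ) < M := by exact_mod_cast Nat.pos_of_ne_zero (NeZero.ne M)
    calc 2 * π / M = 2 * π / M * 1 := (mul_one _).symm
      _ ≤ 2 * π / M * (supNorm κ : ℝ) := mul_le_mul_of_nonneg_left hs (by positivity)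
      _ ≤ momNorm κ := h1
  have hM' : (M : ℝ) = (L : ℝ) ^ N := by rw [hM]; push_cast; rfl
  have hcontra : ((L : ℝ) ^ j)⁻¹ < 2 * π / M := by
    rw [hM']
    calc ((L : ℝ) ^ j)⁻¹ ≤ ((L : ℝ) ^ (N + 1))⁻¹ := inv_anti₀ (by positivity) (pow_le_pow_right₀ hL1 (by omega))
      _ = (L : ℝ)⁻¹ * ((L : ℝ) ^ N)⁻¹ := by rw [pow_succ, mul_inv, mul_comm]
      _ < 2 * π * ((L : ℝ) ^ N)⁻¹ := by
          refine mul_lt_mul_of_pos_right ?_ (by positivity)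
          calc (L : ℝ)⁻¹ ≤ 1 := inv_le_one_of_one_le₀ hL1
            _ < 2 * π := by linarith [Real.pi_gt_three]
      _ = 2 * π / (L : ℝ) ^ N := by rw [div_eq_mul_inv]
  linarith

omit [NeZero M] in
/-- In a shell `𝔸_j` with `j ≥ k ≥ 1`: `|p| ≤ L^{-k}`. [cite: Buchholz2016, §2 (the annuli 𝔸_j)] -/
theorem momNorm_le_of_inShell {L : ℕ} (hL : 1 ≤ L) {j k : ℕ} {κ : Fin d → ZMod M} (hj : InShell L j κ) (hk1 : 1 ≤ k)
    (hkj : k ≤ j) : momNorm κ ≤ ((L : ℝ) ^ k)⁻¹ := by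
  have hL1 : (1 : ℝ) ≤ L := by exact_mod_cast hL
  rcases hj with ⟨h0, _⟩ | ⟨_, _, h2⟩
  · omega
  · exact h2.trans (inv_anti₀ (by positivity) (pow_le_pow_right₀ hL1 hkj))

omit [NeZero M] in
/-- In a shell `𝔸_j`: `L^{-(j+1)} < |p|`. [cite: Buchholz2016, §2 (the annuli 𝔸_j)] -/
theorem lt_momNorm_of_inShell {L : ℕ} {j : ℕ} {κ : Fin d → ZMod M} (hj : InShell L j κ) :
    ((L : ℝ) ^ (j + 1))⁻¹ < momNorm κ := by
  rcases hj with ⟨h0, h1⟩ | ⟨_, h1, _⟩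
  · rw [h0, zero_add]; exact h1
  · exact h1

/-- `|p|² ≤ d π²`. [cite: Buchholz2016, §2 (dual torus)] -/
theorem momNorm_sq_le (κ : Fin d → ZMod M) : momNorm κ ^ 2 ≤ d * π ^ 2 := by
  rw [momNorm, Real.sq_sqrt (sum_nonneg fun i _ => sq_nonneg _)]
  calc ∑ i, dualMomentum κ i ^ 2 ≤ ∑ _i : Fin d, π ^ 2 := sum_le_sum fun i _ => by
        have h := abs_dualMomentum_le κ i
        rw [← sq_abs]; exact pow_le_pow_left₀ (abs_nonneg _) h 2
    _ = d * π ^ 2 := by rw [sum_const, card_univ, Fintype.card_fin, nsmul_eq_mul]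

/-! ## Tools: derivatives of finite sums -/

/-- Iterated derivatives of finite linear combinations (pointwise smoothness). [folklore] -/
private theorem iteratedDeriv_finset_sum {ι : Type*} (S : Finset ι) (w : ι → ℝ) (f : ι → ℝ → ℝ) (n : ℕ) (x : ℝ)
    (hf : ∀ i ∈ S, ContDiffAt ℝ n (f i) x) :
    iteratedDeriv n (fun s => ∑ i ∈ S, w i * f i s) x = ∑ i ∈ S, w i * iteratedDeriv n (f i) x := by
  classical
  induction S using Finset.induction_on with
  | empty => simp
  | insert a S ha ih =>
    have hfS : ∀ i ∈ S, ContDiffAt ℝ n (f i) x := fun i hi => hf i (Finset.mem_insert_of_mem hi)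
    have hfa : ContDiffAt ℝ n (f a) x := hf a (Finset.mem_insert_self a S)
    have hsum : ContDiffAt ℝ n (fun s => ∑ i ∈ S, w i * f i s) x :=
      ContDiffAt.sum fun i hi => contDiffAt_const.mul (hfS i hi)
    simp only [Finset.sum_insert ha]
    have hadd : (fun s => w a * f a s + ∑ i ∈ S, w i * f i s) = (fun s => w a * f a s) + fun s => ∑ i ∈ S, w i * f i s := rfl
    rw [hadd, iteratedDeriv_add (contDiffAt_const.mul hfa) hsum, ih hfS]
    congr 1
    exact iteratedDeriv_const_mul (w a) hfa

/-! ## The mixed multipliers `𝒟̂^ν_k` -/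

/-- The exponent `γ = d − 1 + ν` of Prop 3.1 (`λ_{k,j} = L^{-(k-j)(d-1+ν)}`). [cite: Buchholz2016, Prop 3.1 (proof)] -/
def gammaExp (d ν : ℕ) : ℕ := d - 1 + ν

/-- The mixed multiplier `𝒟̂^ν_k(A,κ) = Σ_{j≤k} λ^ν_{k,j} ĉ_j(A,κ)`. [cite: Buchholz2016, Prop 3.1 (3.8)] -/
def mixMult (Ω₀ : ℝ) (ν L N k : ℕ) (A : Matrix (Fin d) (Fin d) ℝ) (κ : Fin d → ZMod M) : ℝ :=
  mix (L : ℝ) (gammaExp d ν) N (fun j => baseMult Ω₀ L N j A κ) k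

/-- `γ ≥ 1` for `d ≥ 2`. [cite: Buchholz2016, Prop 3.1 (proof)] -/
theorem one_le_gammaExp {d : ℕ} (hd : 2 ≤ d) (ν : ℕ) : 1 ≤ gammaExp d ν := by unfold gammaExp; omega

/-- `𝒟̂_k ≥ 0`. [cite: Buchholz2016, Prop 3.1 (positivity)] -/
theorem mixMult_nonneg (hd : 2 ≤ d) {ω₀ Ω₀ : ℝ} (hω : 0 < ω₀) (hωΩ : ω₀ < Ω₀) {A : Matrix (Fin d) (Fin d) ℝ}
    (hA : IsElliptic ω₀ Ω₀ A) (ν : ℕ) {L : ℕ} (hL : 5 ≤ L) (N k : ℕ) {κ : Fin d → ZMod M} (hκ : κ ≠ 0) :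
    0 ≤ mixMult Ω₀ ν L N k A κ := by
  have hL' : (5 : ℝ) ≤ (L : ℝ) := by exact_mod_cast hL
  exact mix_nonneg hL' (one_le_gammaExp hd ν) N (fun j _ => baseMult_nonneg hω hωΩ (by omega) hA L N j hκ) k

/-- **`Σ_k 𝒟̂_k = 1/â`**. [cite: Buchholz2016, Prop 3.1 (𝒞_A = Σ 𝒟_{A,k})] -/
theorem sum_mixMult {ω₀ Ω₀ : ℝ} (hω : 0 < ω₀) {A : Matrix (Fin d) (Fin d) ℝ} (hA : IsElliptic ω₀ Ω₀ A) (ν L N : ℕ)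
    {κ : Fin d → ZMod M} (hκ : κ ≠ 0) : ∑ k ∈ Finset.Icc 1 (N + 1), mixMult Ω₀ ν L N k A κ = 1 / symbR A κ := by
  unfold mixMult
  rw [sum_mix, sum_baseMult hω hA L N hκ]

/-- The lower-bound constant `c_low = (2048 π⁴ d B)^{-1}`. [cite: Buchholz2016, Prop 3.1 (3.5)] -/
def cLow (d : ℕ) (Ω₀ : ℝ) : ℝ := 1 / (2048 * π ^ 4 * d * band d Ω₀)

/-- `c_low > 0`. [cite: Buchholz2016, Prop 3.1 (3.5)] -/
theorem cLow_pos (hd : 1 ≤ d) {Ω₀ : ℝ} (hΩ : 0 < Ω₀) : 0 < cLow d Ω₀ := by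
  have hB := (band_pos_of (d := d) hΩ hd).1
  have : (0 : ℝ) < d := by exact_mod_cast (show 0 < d by omega)
  unfold cLow; positivity

/-- `c_low ≤ (4096 π² B)^{-1}` (`d ≥ 1`), hence also `≤ (2048 π² B)^{-1}` and `= (1024 π⁴ d B)^{-1}/2`.
[cite: Buchholz2016, Prop 3.1 (3.5)] -/
theorem cLow_le (hd : 1 ≤ d) {Ω₀ : ℝ} (hΩ : 0 < Ω₀) : cLow d Ω₀ ≤ 1 / (4096 * π ^ 2 * band d Ω₀) := by
  have hB := (band_pos_of (d := d) hΩ hd).1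
  have hd' : (1 : ℝ) ≤ d := by exact_mod_cast hd
  unfold cLow
  refine one_div_le_one_div_of_le (by positivity) ?_
  have hπ : (2 : ℝ) ≤ π ^ 2 := by nlinarith [Real.pi_gt_three]
  have : (4096 : ℝ) * π ^ 2 ≤ 2048 * π ^ 4 * d := by nlinarith [mul_le_mul hπ hd' zero_le_one (by positivity), Real.pi_pos]
  nlinarith

/-- **Lower bound (3.5), shells `j ≥ k`**: `𝒟̂_k ≥ c_low L^{2k}`. [cite: Buchholz2016, Prop 3.1 (3.5), (3.10)] -/
theorem mixMult_lower_ge (hd : 2 ≤ d) {ω₀ Ω₀ : ℝ} (hω : 0 < ω₀) (hωΩ : ω₀ < Ω₀) {A : Matrix (Fin d) (Fin d) ℝ}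
    (hA : IsElliptic ω₀ Ω₀ A) (ν : ℕ) {L N : ℕ} (hL : 5 ≤ L) (hM : M = L ^ N) {k j : ℕ} (hk1 : 1 ≤ k) (hkj : k ≤ j)
    {κ : Fin d → ZMod M} (hκ : κ ≠ 0) (hj : InShell L j κ) :
    cLow d Ω₀ * (L : ℝ) ^ (2 * k) ≤ mixMult Ω₀ ν L N k A κ := by
  have hL' : (5 : ℝ) ≤ (L : ℝ) := by exact_mod_cast hL
  have hjN := inShell_le hL hM hκ hj
  have hkN : k ≤ N := hkj.trans hjN
  have hp := momNorm_le_of_inShell (by omega) hj hk1 hkj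
  have hbase := baseMult_ge_pow (M := M) (N := N) (by omega) hω hωΩ hA hL hkN hκ hp
  have hmix := half_mul_le_mix hL' (one_le_gammaExp hd ν) N
    (c := fun j => baseMult Ω₀ L N j A κ) (fun j _ => baseMult_nonneg hω hωΩ (by omega) hA L N j hκ) hk1
  unfold mixMult
  refine le_trans ?_ (le_trans (div_le_div_of_nonneg_right hbase (by norm_num)) hmix)
  have hB := (band_pos_of (d := d) (hω.trans hωΩ) (by omega)).1
  have hc := cLow_le (d := d) (by omega) (hω.trans hωΩ)
  calc cLow d Ω₀ * (L : ℝ) ^ (2 * k) ≤ 1 / (4096 * π ^ 2 * band d Ω₀) * (L : ℝ) ^ (2 * k) :=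
        mul_le_mul_of_nonneg_right hc (by positivity)
    _ = (L : ℝ) ^ (2 * k) / (2048 * π ^ 2 * band d Ω₀) / 2 := by field_simp; ring

/-- **Lower bound (3.5), shells `j < k`**: `𝒟̂_k ≥ c_low L^{2j} L^{-(k-j)γ}`.
[cite: Buchholz2016, Prop 3.1 (3.5), (3.11)–(3.12)] -/
theorem mixMult_lower_lt (hd : 2 ≤ d) {ω₀ Ω₀ : ℝ} (hω : 0 < ω₀) (hωΩ : ω₀ < Ω₀) {A : Matrix (Fin d) (Fin d) ℝ}
    (hA : IsElliptic ω₀ Ω₀ A) (ν : ℕ) {L N : ℕ} (hL : 5 ≤ L) (hN : 1 ≤ N) (hM : M = L ^ N) {k j : ℕ} (hjk : j < k)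
    (hk : k ≤ N + 1) {κ : Fin d → ZMod M} (hκ : κ ≠ 0) (hj : InShell L j κ) :
    cLow d Ω₀ * (L : ℝ) ^ (2 * j) / (L : ℝ) ^ ((k - j) * gammaExp d ν) ≤ mixMult Ω₀ ν L N k A κ := by
  have hL' : (5 : ℝ) ≤ (L : ℝ) := by exact_mod_cast hL
  have hL0 : (0 : ℝ) < L := by linarith
  have hL1 : (1 : ℝ) ≤ L := by linarith
  have hγ := one_le_gammaExp hd ν
  have hΩ := hω.trans hωΩ
  have hB := (band_pos_of (d := d) hΩ (by omega)).1
  have hd' : (1 : ℝ) ≤ d := by exact_mod_cast (show 1 ≤ d by omega)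
  have hc0 := cLow_pos (d := d) (by omega) hΩ
  have hcle := cLow_le (d := d) (by omega) hΩ
  have hnonneg : ∀ j', 1 ≤ j' → 0 ≤ baseMult Ω₀ L N j' A κ := fun j' _ => baseMult_nonneg hω hωΩ (by omega) hA L N j' hκ
  unfold mixMult
  rcases Nat.eq_zero_or_pos j with hj0 | hjpos
  · -- shell `𝔸_0`: use `ĉ_1 ≥ (1024π²B)^{-1} |p|^{-2} ≥ (1024 π⁴ d B)^{-1}`
    subst hj0
    have hlow1 := baseMult_one_ge (M := M) (by omega) hω hωΩ hA L hN hκ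
    have hmin : 1 / (d * π ^ 2) ≤ min ((L : ℝ) ^ 2) ((momNorm κ ^ 2)⁻¹) := by
      refine le_min ?_ ?_
      · calc 1 / (d * π ^ 2) ≤ 1 := by
              rw [div_le_one (by positivity)]; nlinarith [Real.pi_gt_three]
          _ ≤ (L : ℝ) ^ 2 := one_le_pow₀ hL1
      · rw [one_div, inv_le_inv₀ (by positivity) (pow_pos (momNorm_pos hκ) 2)]
        exact momNorm_sq_le κ
    have hc1 : 1 / (1024 * π ^ 4 * d * band d Ω₀) ≤ baseMult Ω₀ L N 1 A κ := by
      refine le_trans ?_ hlow1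
      calc 1 / (1024 * π ^ 4 * d * band d Ω₀) = 1 / (1024 * π ^ 2 * band d Ω₀) * (1 / (d * π ^ 2)) := by
            field_simp
        _ ≤ 1 / (1024 * π ^ 2 * band d Ω₀) * min ((L : ℝ) ^ 2) ((momNorm κ ^ 2)⁻¹) :=
            mul_le_mul_of_nonneg_left hmin (by positivity)
    have hcLow2 : cLow d Ω₀ = 1 / (1024 * π ^ 4 * d * band d Ω₀) / 2 := by unfold cLow; field_simp; ring
    simp only [mul_zero, pow_zero, mul_one, Nat.sub_zero]
    rcases lt_or_eq_of_le (show 1 ≤ k by omega) with h1k | h1k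
    · have hmix := inv_pow_mul_le_mix hL' hγ N (c := fun j => baseMult Ω₀ L N j A κ) hnonneg le_rfl h1k
      refine le_trans ?_ (hmix.trans' (mul_le_mul_of_nonneg_left hc1 (by positivity)))
      calc cLow d Ω₀ / (L : ℝ) ^ (k * gammaExp d ν) ≤ cLow d Ω₀ / (L : ℝ) ^ ((k - 1) * gammaExp d ν) :=
            div_le_div_of_nonneg_left hc0.le (by positivity)
              (pow_le_pow_right₀ hL1 (Nat.mul_le_mul_right _ (by omega)))
        _ ≤ 1 / (1024 * π ^ 4 * d * band d Ω₀) / (L : ℝ) ^ ((k - 1) * gammaExp d ν) := by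
            refine div_le_div_of_nonneg_right ?_ (by positivity)
            rw [hcLow2]; exact half_le_self (by positivity)
        _ = ((L : ℝ) ^ ((k - 1) * gammaExp d ν))⁻¹ * (1 / (1024 * π ^ 4 * d * band d Ω₀)) := by
            rw [div_eq_mul_inv, mul_comm]
    · subst h1k
      have hmix := half_mul_le_mix hL' hγ N (c := fun j => baseMult Ω₀ L N j A κ) hnonneg le_rfl
      refine le_trans ?_ (hmix.trans' (div_le_div_of_nonneg_right hc1 (by norm_num)))
      calc cLow d Ω₀ / (L : ℝ) ^ (1 * gammaExp d ν) ≤ cLow d Ω₀ := div_le_self hc0.le (one_le_pow₀ hL1)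
        _ = 1 / (1024 * π ^ 4 * d * band d Ω₀) / 2 := hcLow2
  · -- shell `𝔸_j`, `1 ≤ j < k`: use `ĉ_j ≥ L^{2j}/(2048 π² B)`
    have hjN := inShell_le hL hM hκ hj
    have hp := momNorm_le_of_inShell (by omega) hj hjpos le_rfl
    have hbase := baseMult_ge_pow (M := M) (N := N) (by omega) hω hωΩ hA hL hjN hκ hp
    have hmix := inv_pow_mul_le_mix hL' hγ N (c := fun j => baseMult Ω₀ L N j A κ) hnonneg hjpos hjk
    refine le_trans ?_ (hmix.trans' (mul_le_mul_of_nonneg_left hbase (by positivity)))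
    rw [div_eq_mul_inv, mul_comm]
    refine mul_le_mul_of_nonneg_left ?_ (by positivity)
    calc cLow d Ω₀ * (L : ℝ) ^ (2 * j) ≤ 1 / (4096 * π ^ 2 * band d Ω₀) * (L : ℝ) ^ (2 * j) :=
          mul_le_mul_of_nonneg_right hcle (by positivity)
      _ ≤ 1 / (2048 * π ^ 2 * band d Ω₀) * (L : ℝ) ^ (2 * j) := by
          refine mul_le_mul_of_nonneg_right (one_div_le_one_div_of_le (by positivity) (by nlinarith [Real.pi_pos])) ?_
          positivity
      _ = (L : ℝ) ^ (2 * j) / (2048 * π ^ 2 * band d Ω₀) := by ring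

/-- The directional derivative of `𝒟̂_k` is the mixing of the directional derivatives.
[cite: Buchholz2016, Prop 3.1 (proof, (3.9))] -/
theorem iteratedDeriv_mixMult {ω₀ Ω₀ : ℝ} (hω : 0 < ω₀) {A : Matrix (Fin d) (Fin d) ℝ} (hA : IsElliptic ω₀ Ω₀ A)
    {B' : Matrix (Fin d) (Fin d) ℝ} (hB' : IsUnitSymm B') (ν L N k : ℕ) (κ : Fin d → ZMod M) (ℓ : ℕ) :
    iteratedDeriv ℓ (fun s : ℝ => mixMult Ω₀ ν L N k (A + s • B') κ) 0 =
      mix (L : ℝ) (gammaExp d ν) N (fun j => iteratedDeriv ℓ (fun s : ℝ => baseMult Ω₀ L N j (A + s • B') κ) 0) k := by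
  unfold mixMult mix
  exact iteratedDeriv_finset_sum _ _ (fun j s => baseMult Ω₀ L N j (A + s • B') κ) ℓ 0 fun j _ =>
    (contDiffOn_baseMult hω hA hB' L N j κ).contDiffAt (Ioo_mem_nhds (by linarith) hω)

/-- **Upper bounds (3.6)/(3.13) for all directional derivatives**: for every `ℓ` there is `U` such that
for all `L ≥ 5`, `N ≥ 1`, `M = L^N`, `A ∈ 𝓛`, `‖Ȧ‖ ≤ 1`, `1 ≤ k ≤ N+1`, `κ ≠ 0` in the shell `𝔸_j`:
`|∂_s^ℓ 𝒟̂^ν_k| ≤ U L^{2(d+ν)+1} L^{2j} L^{-(k-j)γ}` if `j < k`, and `≤ U L^{2k}` always.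
[cite: Buchholz2016, Prop 3.1 (3.6), (3.13)–(3.16)] -/
theorem exists_mixMult_deriv_upper (d : ℕ) (hd : 2 ≤ d) {ω₀ Ω₀ : ℝ} (hω : 0 < ω₀) (hωΩ : ω₀ < Ω₀) (ν ℓ : ℕ) :
    ∃ U, 0 ≤ U ∧ ∀ (L N M : ℕ) [NeZero M], 5 ≤ L → 1 ≤ N → M = L ^ N →
      ∀ A : Matrix (Fin d) (Fin d) ℝ, IsElliptic ω₀ Ω₀ A → ∀ B' : Matrix (Fin d) (Fin d) ℝ, IsUnitSymm B' →
        ∀ k, 1 ≤ k → k ≤ N + 1 → ∀ κ : Fin d → ZMod M, κ ≠ 0 →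
          |iteratedDeriv ℓ (fun s : ℝ => mixMult Ω₀ ν L N k (A + s • B') κ) 0| ≤ U * (L : ℝ) ^ (2 * k) ∧
          ∀ j, InShell L j κ → j < k →
            |iteratedDeriv ℓ (fun s : ℝ => mixMult Ω₀ ν L N k (A + s • B') κ) 0| ≤
              U * (L : ℝ) ^ (2 * (d + ν) + 1) * (L : ℝ) ^ (2 * j) / (L : ℝ) ^ ((k - j) * gammaExp d ν) := by
  obtain ⟨U1, hU10, hU1⟩ := exists_baseMult_deriv_le_pow d (by omega) hω hωΩ ℓ
  obtain ⟨U2, hU20, hU2⟩ := exists_baseMult_deriv_le_decay d (by omega) hω hωΩ ℓ (gammaExp d ν + 1)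
  set U : ℝ := max U1 U2 with hU
  refine ⟨4 * U, by positivity, fun L N M _ hL hN hM A hA B' hB' k hk1 hk κ hκ => ?_⟩
  have hL' : (5 : ℝ) ≤ L := by exact_mod_cast hL
  have hL0 : (0 : ℝ) < L := by linarith
  have hγ := one_le_gammaExp hd ν
  have hU0 : 0 ≤ U := le_max_of_le_left hU10
  rw [iteratedDeriv_mixMult hω hA hB' ν L N k κ ℓ]
  set c : ℕ → ℝ := fun j => iteratedDeriv ℓ (fun s : ℝ => baseMult Ω₀ L N j (A + s • B') κ) 0 with hc
  have hc1 : ∀ k', 1 ≤ k' → k' ≤ k → |c k'| ≤ U * (L : ℝ) ^ (2 * k') := fun k' hk1' hk' =>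
    (hU1 L N M hL hN hM A hA B' hB' k' hk1' (by omega) κ hκ).trans
      (mul_le_mul_of_nonneg_right (le_max_left _ _) (by positivity))
  constructor
  · calc |mix (L : ℝ) (gammaExp d ν) N c k| ≤ 2 * U * (L : ℝ) ^ (2 * k) := abs_mix_le_geom hL' hγ N hU0 hc1
      _ ≤ 4 * U * (L : ℝ) ^ (2 * k) := by nlinarith [pow_nonneg hL0.le (2 * k)]
  · intro j hj hjk
    have hx := lt_momNorm_of_inShell hj
    have hp := momNorm_pos hκ
    have hc2 : ∀ k', 1 ≤ k' → k' ≤ k → |c k'| ≤ U / (momNorm κ ^ 2 * (momNorm κ * (L : ℝ) ^ (k' - 1)) ^ (gammaExp d ν + 1)) :=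
      fun k' hk1' hk' => (hU2 L N M hL hN A hA B' hB' k' hk1' (by omega) κ hκ).trans
        (div_le_div_of_nonneg_right (le_max_right _ _) (by positivity))
    have h := abs_mix_le_decay hL' hγ N hU0 hp hjk hx hc1 hc2
    refine h.trans (le_of_eq ?_)
    rw [show 2 * gammaExp d ν + 3 = 2 * (d + ν) + 1 by unfold gammaExp; omega]

/-! ## The quotient bound (3.7) and the reference operator -/

/-- The reference operator `A₀ = Ω₀ · 1` (Buchholz uses `−Δ`; any fixed member of `𝓛(ω₀,Ω₀)` does).
[cite: Buchholz2016, proof of Thm 2.4 ("for simplicity we choose −Δ")] -/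
def refOp (d : ℕ) (Ω₀ : ℝ) : Matrix (Fin d) (Fin d) ℝ := Ω₀ • (1 : Matrix (Fin d) (Fin d) ℝ)

/-- `A₀ ∈ 𝓛(ω₀, Ω₀)`. [cite: Buchholz2016, proof of Thm 2.4] -/
theorem refOp_isElliptic {ω₀ Ω₀ : ℝ} (hωΩ : ω₀ ≤ Ω₀) : IsElliptic ω₀ Ω₀ (refOp d Ω₀) := by
  refine ⟨(Matrix.isSymm_one).smul Ω₀, fun z => ?_⟩
  have hq : ∑ i, ∑ j, z i * refOp d Ω₀ i j * z j = Ω₀ * ∑ i, z i ^ 2 := by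
    unfold refOp
    rw [Finset.mul_sum]
    refine sum_congr rfl fun i _ => ?_
    rw [Finset.sum_eq_single i (fun j _ hji => by simp [Matrix.one_apply_ne (Ne.symm hji)]) (by simp)]
    simp [Matrix.one_apply_eq]; ring
  rw [hq]
  exact ⟨mul_le_mul_of_nonneg_right hωΩ (sum_nonneg fun i _ => sq_nonneg _), le_rfl⟩

/-- **The quotient bound (3.7)**: there is `K ≥ 1` with `|𝒟̂^ν_k(A',κ)| ≤ K L^{2(d+ν)+1} 𝒟̂^ν_k(A,κ)` for all
`A, A' ∈ 𝓛(ω₀,Ω₀)`, all `κ ≠ 0`, `1 ≤ k ≤ N+1`. [cite: Buchholz2016, Prop 3.1 (3.7)] -/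
theorem exists_mixMult_ratio (d : ℕ) (hd : 2 ≤ d) {ω₀ Ω₀ : ℝ} (hω : 0 < ω₀) (hωΩ : ω₀ < Ω₀) (ν : ℕ) :
    ∃ K, 1 ≤ K ∧ ∀ (L N M : ℕ) [NeZero M], 5 ≤ L → 1 ≤ N → M = L ^ N →
      ∀ A A' : Matrix (Fin d) (Fin d) ℝ, IsElliptic ω₀ Ω₀ A → IsElliptic ω₀ Ω₀ A' →
        ∀ k, 1 ≤ k → k ≤ N + 1 → ∀ κ : Fin d → ZMod M, κ ≠ 0 →
          |mixMult Ω₀ ν L N k A' κ| ≤ K * (L : ℝ) ^ (2 * (d + ν) + 1) * mixMult Ω₀ ν L N k A κ := by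
  obtain ⟨U, hU0, hU⟩ := exists_mixMult_deriv_upper d hd hω hωΩ ν 0
  have hc := cLow_pos (d := d) (by omega) (hω.trans hωΩ)
  refine ⟨max 1 (U / cLow d Ω₀), le_max_left _ _, fun L N M _ hL hN hM A A' hA hA' k hk1 hk κ hκ => ?_⟩
  have hL' : (5 : ℝ) ≤ L := by exact_mod_cast hL
  have hL1 : (1 : ℝ) ≤ L := by linarith
  obtain ⟨j, hj⟩ := exists_inShell (L := L) (by omega) hκ
  -- the unit direction is irrelevant at order `0`; use `Ȧ = 0`
  have h0 : IsUnitSymm (0 : Matrix (Fin d) (Fin d) ℝ) := ⟨Matrix.isSymm_zero, fun z => by simp [sum_nonneg, sq_nonneg]⟩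
  have hup := hU L N M hL hN hM A' hA' 0 h0 k hk1 hk κ hκ
  simp only [iteratedDeriv_zero, smul_zero, add_zero] at hup
  have hKU : U ≤ max 1 (U / cLow d Ω₀) * cLow d Ω₀ := by
    calc U = U / cLow d Ω₀ * cLow d Ω₀ := by field_simp
      _ ≤ max 1 (U / cLow d Ω₀) * cLow d Ω₀ := mul_le_mul_of_nonneg_right (le_max_right _ _) hc.le
  have hLpow : (1 : ℝ) ≤ (L : ℝ) ^ (2 * (d + ν) + 1) := one_le_pow₀ hL1
  rcases lt_or_ge j k with hjk | hkj
  · have hlow := mixMult_lower_lt hd hω hωΩ hA ν hL hN hM hjk hk hκ hj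
    have h1 := hup.2 j hj hjk
    calc |mixMult Ω₀ ν L N k A' κ| ≤ U * (L : ℝ) ^ (2 * (d + ν) + 1) * (L : ℝ) ^ (2 * j) / (L : ℝ) ^ ((k - j) * gammaExp d ν) := h1
      _ ≤ (max 1 (U / cLow d Ω₀) * cLow d Ω₀) * (L : ℝ) ^ (2 * (d + ν) + 1) * (L : ℝ) ^ (2 * j) /
            (L : ℝ) ^ ((k - j) * gammaExp d ν) := by gcongr
      _ = max 1 (U / cLow d Ω₀) * (L : ℝ) ^ (2 * (d + ν) + 1) *
            (cLow d Ω₀ * (L : ℝ) ^ (2 * j) / (L : ℝ) ^ ((k - j) * gammaExp d ν)) := by ring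
      _ ≤ max 1 (U / cLow d Ω₀) * (L : ℝ) ^ (2 * (d + ν) + 1) * mixMult Ω₀ ν L N k A κ :=
          mul_le_mul_of_nonneg_left hlow (by positivity)
  · have hlow := mixMult_lower_ge hd hω hωΩ hA ν hL hM hk1 hkj hκ hj
    calc |mixMult Ω₀ ν L N k A' κ| ≤ U * (L : ℝ) ^ (2 * k) := hup.1
      _ ≤ (max 1 (U / cLow d Ω₀) * cLow d Ω₀) * (L : ℝ) ^ (2 * k) := by gcongr
      _ = max 1 (U / cLow d Ω₀) * 1 * (cLow d Ω₀ * (L : ℝ) ^ (2 * k)) := by ring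
      _ ≤ max 1 (U / cLow d Ω₀) * (L : ℝ) ^ (2 * (d + ν) + 1) * mixMult Ω₀ ν L N k A κ := by
          refine mul_le_mul (mul_le_mul_of_nonneg_left hLpow (by positivity)) hlow (by positivity) (by positivity)

/-! ## The final multipliers (proof of Thm 2.4) -/

/-- The small parameter `θ = L^{-2(d+ñ)-1}/K` of the proof of Thm 2.4. [cite: Buchholz2016, proof of Thm 2.4 (3.17)] -/
def thetaC (d ñ : ℕ) (K : ℝ) (L : ℕ) : ℝ := (((L : ℝ) ^ (2 * (d + ñ) + 1)))⁻¹ / K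

/-- The final multiplier `f_k(A,κ) = 𝒟̂^ñ_k(A) − θ 𝒟̂^ñ_k(A₀) + θ 𝒟̂^n_k(A₀)`.
[cite: Buchholz2016, proof of Thm 2.4 (3.17)] -/
def finalMult (Ω₀ : ℝ) (n ñ : ℕ) (K : ℝ) (L N k : ℕ) (A : Matrix (Fin d) (Fin d) ℝ) (κ : Fin d → ZMod M) : ℝ :=
  mixMult Ω₀ ñ L N k A κ - thetaC d ñ K L * mixMult Ω₀ ñ L N k (refOp d Ω₀) κ +
    thetaC d ñ K L * mixMult Ω₀ n L N k (refOp d Ω₀) κ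

/-- `0 < θ ≤ 1` for `K ≥ 1`, `L ≥ 1`. [cite: Buchholz2016, proof of Thm 2.4 ("K ≥ 1")] -/
theorem thetaC_pos_le {d ñ : ℕ} {K : ℝ} (hK : 1 ≤ K) {L : ℕ} (hL : 1 ≤ L) : 0 < thetaC d ñ K L ∧ thetaC d ñ K L ≤ 1 := by
  have hL1 : (1 : ℝ) ≤ L := by exact_mod_cast hL
  have hK0 : 0 < K := by linarith
  have hpow : (1 : ℝ) ≤ (L : ℝ) ^ (2 * (d + ñ) + 1) := one_le_pow₀ hL1
  unfold thetaC
  refine ⟨by positivity, ?_⟩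
  rw [div_le_one hK0]
  exact (inv_le_one_of_one_le₀ hpow).trans hK

/-- `θ L^{2(d+ñ)+1} K = 1`. [cite: Buchholz2016, proof of Thm 2.4 (3.21)] -/
theorem thetaC_mul {d ñ : ℕ} {K : ℝ} (hK : 0 < K) {L : ℕ} (hL : 1 ≤ L) :
    thetaC d ñ K L * (K * (L : ℝ) ^ (2 * (d + ñ) + 1)) = 1 := by
  have hL0 : (0 : ℝ) < L := by exact_mod_cast (show 0 < L by omega)
  unfold thetaC
  field_simp

/-- **Positivity of the final multipliers** (the key step of Thm 2.4): given the quotient bound (3.7) for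
`A` and the reference operator, `f_k(A,κ) ≥ θ 𝒟̂^n_k(A₀,κ) ≥ 0`. [cite: Buchholz2016, proof of Thm 2.4 (3.21)] -/
theorem finalMult_ge (hd : 2 ≤ d) {ω₀ Ω₀ : ℝ} (hω : 0 < ω₀) (hωΩ : ω₀ < Ω₀) {A : Matrix (Fin d) (Fin d) ℝ}
    {n ñ : ℕ} {K : ℝ} (hK : 1 ≤ K) {L : ℕ} (hL : 5 ≤ L) (N k : ℕ) {κ : Fin d → ZMod M} (hκ : κ ≠ 0)
    (hratio : |mixMult Ω₀ ñ L N k (refOp d Ω₀) κ| ≤ K * (L : ℝ) ^ (2 * (d + ñ) + 1) * mixMult Ω₀ ñ L N k A κ) :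
    thetaC d ñ K L * mixMult Ω₀ n L N k (refOp d Ω₀) κ ≤ finalMult Ω₀ n ñ K L N k A κ ∧
      0 ≤ finalMult Ω₀ n ñ K L N k A κ := by
  have hθ := thetaC_pos_le (d := d) (ñ := ñ) hK (show 1 ≤ L by omega)
  have hK0 : 0 < K := by linarith
  have h1 : thetaC d ñ K L * mixMult Ω₀ ñ L N k (refOp d Ω₀) κ ≤ mixMult Ω₀ ñ L N k A κ := by
    calc thetaC d ñ K L * mixMult Ω₀ ñ L N k (refOp d Ω₀) κ ≤ thetaC d ñ K L * |mixMult Ω₀ ñ L N k (refOp d Ω₀) κ| :=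
          mul_le_mul_of_nonneg_left (le_abs_self _) hθ.1.le
      _ ≤ thetaC d ñ K L * (K * (L : ℝ) ^ (2 * (d + ñ) + 1) * mixMult Ω₀ ñ L N k A κ) :=
          mul_le_mul_of_nonneg_left hratio hθ.1.le
      _ = mixMult Ω₀ ñ L N k A κ := by
          rw [← mul_assoc, thetaC_mul hK0 (show 1 ≤ L by omega), one_mul]
  have h2 : 0 ≤ thetaC d ñ K L * mixMult Ω₀ n L N k (refOp d Ω₀) κ :=
    mul_nonneg hθ.1.le (mixMult_nonneg hd hω hωΩ (refOp_isElliptic hωΩ.le) n hL N k hκ)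
  unfold finalMult
  constructor <;> linarith

/-- **The final multipliers sum to the covariance symbol**: `Σ_{k=1}^{N+1} f_k(A,κ) = 1/â(κ)` (`κ ≠ 0`).
[cite: Buchholz2016, proof of Thm 2.4 (3.18)] -/
theorem sum_finalMult {ω₀ Ω₀ : ℝ} (hω : 0 < ω₀) (hωΩ : ω₀ < Ω₀) {A : Matrix (Fin d) (Fin d) ℝ}
    (hA : IsElliptic ω₀ Ω₀ A) (n ñ : ℕ) (K : ℝ) (L N : ℕ) {κ : Fin d → ZMod M} (hκ : κ ≠ 0) :
    ∑ k ∈ Finset.Icc 1 (N + 1), finalMult Ω₀ n ñ K L N k A κ = 1 / symbR A κ := by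
  unfold finalMult
  rw [Finset.sum_add_distrib, Finset.sum_sub_distrib, ← Finset.mul_sum, ← Finset.mul_sum, sum_mixMult hω hA ñ L N hκ,
    sum_mixMult hω (refOp_isElliptic hωΩ.le) ñ L N hκ, sum_mixMult hω (refOp_isElliptic hωΩ.le) n L N hκ]
  ring

/-- Only the first term of `f_k(A + sȦ)` depends on `s`: for `ℓ ≥ 1`,
`∂_s^ℓ f_k(A+sȦ,κ) = ∂_s^ℓ 𝒟̂^ñ_k(A+sȦ,κ)`. [cite: Buchholz2016, proof of Thm 2.4 ("only the first term depends on A")] -/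
theorem iteratedDeriv_finalMult (Ω₀ : ℝ) (n ñ : ℕ) (K : ℝ) (L N k : ℕ) (A B' : Matrix (Fin d) (Fin d) ℝ)
    (κ : Fin d → ZMod M) {ℓ : ℕ} (hℓ : 1 ≤ ℓ) :
    iteratedDeriv ℓ (fun s : ℝ => finalMult Ω₀ n ñ K L N k (A + s • B') κ) 0 =
      iteratedDeriv ℓ (fun s : ℝ => mixMult Ω₀ ñ L N k (A + s • B') κ) 0 := by
  have hfun : (fun s : ℝ => finalMult Ω₀ n ñ K L N k (A + s • B') κ) = fun s =>
      (-(thetaC d ñ K L * mixMult Ω₀ ñ L N k (refOp d Ω₀) κ) + thetaC d ñ K L * mixMult Ω₀ n L N k (refOp d Ω₀) κ) +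
        mixMult Ω₀ ñ L N k (A + s • B') κ := by
    funext s; unfold finalMult; ring
  rw [hfun, iteratedDeriv_const_add hℓ]

/-- `γ_n ≤ γ_ñ` and the shell-exponent comparison `L^{-(k-j)γ_ñ} ≤ L^{-(k-j)γ_n}` for `n ≤ ñ`.
[cite: Buchholz2016, proof of Thm 2.4 (the upper bounds)] -/
theorem div_pow_gammaExp_mono {L : ℝ} (hL : 1 ≤ L) {n ñ : ℕ} (hnñ : n ≤ ñ) (d k j : ℕ) {X : ℝ} (hX : 0 ≤ X) :
    X / L ^ ((k - j) * gammaExp d ñ) ≤ X / L ^ ((k - j) * gammaExp d n) := by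
  have hL0 : 0 < L := by linarith
  refine div_le_div_of_nonneg_left hX (by positivity) (pow_le_pow_right₀ hL (Nat.mul_le_mul_left _ ?_))
  unfold gammaExp; omega

end Literature.MathematicalPhysics.StatisticalMechanics.GradientFRD

end
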